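/-
Origin: expansion seat `planner-pub-hodgecm-pv13-0`, handover 2026-08-18T04:08:43Z (`HOME/pub-hodgecm-pv13/lean/Pv13/RallisEuler.lean`, md5 ab5346dd, 69 lines);
landed by the gen-5 packager in gate run 21 as `HodgeCM/PerL34/RallisEuler.lean` (import ^import Pv[0-9]+\.→import HodgeCM.PerL34. ×1).
-/
/-
Origin: pub-hodgecm-pv13 (DAG-NODE PROVER #13) — by-name glue for seam (I) of the N31 cluster (GAPS.md pv05-X1):
pv09's `RallisIP.rallis_field_of_N31e'` binder `hEuler` is produced from typed restricted-product data
(`EulerFactorisation.Datum`, this seat) + the tail analysis of `EulerProduct` (this seat, landed run 19).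
Imports LANDED `HodgeCM.PerL34.RallisField`, `HodgeCM.PerL34.EulerProduct` and `Pv13.EulerFactorisation`
(→ `HodgeCM.PerL34.EulerFactorisation`).  Proposed place: `HodgeCM/PerL34/RallisEuler.lean`,
namespace `HodgeCM.PerL34.EulerFactorisation`.  Nothing cited, nothing asserted.
-/
import Summits.HodgeConjecture.HodgeCM.PerL34.RallisField
import Summits.HodgeConjecture.HodgeCM.PerL34.EulerProduct_2
import Summits.HodgeConjecture.HodgeCM.PerL34.EulerFactorisation

set_option autoImplicit false

/-!
# Seam (I) closed by name modulo typed data: `hEuler` and the `rallis` field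

* `hEuler_of_pieces` — for the adelic matrix coefficient `F(y) = ⟪φ, ω(y)φ⟫ χ'(y)`: restricted-product data
  `D : Datum μ F V` whose local integrals are the REAL numbers `I_v` (tex l. 612) satisfying the unramified
  evaluations of N31g (`EulerProduct.TailHyps`) with `Σ_{v∉S} q_v^{-3/2} < ∞` ⇒
  `∫ F dμ = ((∏' v, I_v : ℝ) : ℂ)` — the exact type of pv09's binder `hEuler` with `P := ∏' v, I v`.
* `rallis_of_pieces` — composed with pv09's `rallis_field_of_N31e'`:
  `re ⟪θ, θ⟫ = c · vol · ∏' v, I_v`, the exact type of the field `EulerProduct.LocalFactorDatum.rallis`.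
So along N31e → N31 the only non-kernel inputs left are the FIELDS of `Datum` (restricted-product structure of
`U(W_i)(𝔸)` and of `ω = ⊗' ω_v` on pure tensors; global integrability l. 608) and the reality `hI` (l. 612).
-/

noncomputable section

open MeasureTheory Complex ComplexConjugate
open scoped InnerProductSpace

namespace HodgeCM
namespace PerL34
namespace EulerFactorisation

variable {A Sp E : Type*} [CommGroup A] [MeasurableSpace A] [NormedAddCommGroup Sp] [InnerProductSpace ℂ Sp]
  [NormedAddCommGroup E] [InnerProductSpace ℂ E]
variable {V : Type} [Countable V]

/-- **`hEuler` from pieces.** -/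
theorem hEuler_of_pieces {μ : Measure A} {ω : A →* (Sp ≃ₗᵢ[ℂ] Sp)} {φ : Sp} {χ' : A → ℂ}
    (D : Datum μ (fun y => ⟪φ, ω y φ⟫_ℂ * χ' y) V) {I : V → ℝ} (hI : ∀ v, D.I v = (I v : ℂ))
    {S : Finset V} {q : V → ℕ} {a : V → ℂ} {IsSplit : V → Prop} (H : EulerProduct.TailHyps S I q a IsSplit)
    (hsum : Summable fun v : {w : V // w ∉ S} => EulerProduct.tOf (q v.1)) :
    ∫ y, ⟪φ, ω y φ⟫_ℂ * χ' y ∂μ = ((∏' v, I v : ℝ) : ℂ) := by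
  have hP : HasProd I (∏' v, I v) := by
    rw [EulerProduct.tprod_eq_eulerValue H hsum]
    exact EulerProduct.hasProd_eulerValue H hsum
  exact D.hEuler_of hI hP

/-- **The `rallis` field of `EulerProduct.LocalFactorDatum` from pieces**: N31e (pv09, PROVED as `N31e_holds`,
entering as the statement `hN31e`), the Petersson-norm identity `hnorm` (pv05 `PeterssonFubini`, kernel), and
seam (I) in the form just proved. -/
theorem rallis_of_pieces {μ : Measure A} {𝓕 : Set A} {ω : A →* (Sp ≃ₗᵢ[ℂ] Sp)} {φ : Sp} {χ' : A → ℂ}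
    {K : A → A → ℂ} {c vol : ℝ} {θ : E} (hvol : vol = (μ 𝓕).toReal)
    (hN31e : RallisIP.N31e_statement μ 𝓕 ω φ χ' K (c : ℂ))
    (hnorm : ⟪θ, θ⟫_ℂ = ∫ u in 𝓕, ∫ u' in 𝓕, χ' u * conj (χ' u') * K u u' ∂μ ∂μ)
    (D : Datum μ (fun y => ⟪φ, ω y φ⟫_ℂ * χ' y) V) {I : V → ℝ} (hI : ∀ v, D.I v = (I v : ℂ))
    {S : Finset V} {q : V → ℕ} {a : V → ℂ} {IsSplit : V → Prop} (H : EulerProduct.TailHyps S I q a IsSplit)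
    (hsum : Summable fun v : {w : V // w ∉ S} => EulerProduct.tOf (q v.1)) :
    RCLike.re ⟪θ, θ⟫_ℂ = c * vol * ∏' v, I v :=
  RallisIP.rallis_field_of_N31e' hvol hN31e hnorm (hEuler_of_pieces D hI H hsum)

end EulerFactorisation
end PerL34
end HodgeCM

end
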